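/-
COR-CM (cells pub-hodgecm / pub-hodgecm2, stage 2 of the Hodge ladder) — TEAM hComp (coordinator ruling 2026-08-21T18:44:30Z (1);
owner of record of the binder `hComp` = pin-1), seat hcomp-abcm-2 «abelian scheme + CM type, part 2: the CM-type / signature
bookkeeping at every archimedean place for a general Galois CM field of degree ≥ 6 and a general rank-four face».
Sub-object (ARCH) of `HOME/pinning/HCOMP-TABLE.md`; path under the pub-hodgecm2 lead's blanket pre-ACK `Transposition/HComp/`
(lead staging 18:45:07Z (1)).  THEOREMS ONLY: no definition, no instance, no named fact, no `variable`, nothing asserted, no proof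
holes; no hypothesis binders (T5: n/a).  Nothing in the tree is edited or restated.  FRAMING: HC_CM is NOT proved; nothing here
discharges `hUnif` / `hAlb` / `hComp`.
-/
import Summits.HodgeConjecture.CorCM.CM.Basic
import Literature.NumberTheory.Automorphic.Liu2021.AppendixC.DefC1toC3Aux
import Literature.NumberTheory.Automorphic.Liu2021.AppendixC.DefC4
import Literature.NumberTheory.Automorphic.Liu2021.AppendixC.PropC5
import HarnessLib

/-!
# Item (vi) S2 / binder `hComp`: the archimedean dictionary between the tree's face datum and [Liu 2021] App. C

The binders of record of the pinning lane (`hComp`, `Transposition/Item6PinReach.lean` :233–242; its re-sourced pair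
{`hUnif`, `hAlb`}, `Transposition/Item6PinReachGlue.lean` :171–189 and `Item6PinReachAlong.lean`) are stated for the TREE'S face
datum — a CM field `F : CMField` (Liu's `E`; Liu's totally real `F` is our `F⁺ := maximalRealSubfield F`), an embedding
`ι₁ : F →+* ℂ`, a CM type `Φ ∋ ι₁`, a hermitian 3-space `V : HermSpace3 F ι₁` (signature `(2,1)` at the place of `ι₁`, `(3,0)`
at every other place, `CorCM/CM/Basic.lean` :182–191) — and CONSUME [Liu2021] Appendix C through the as-printed files
`Literature/NumberTheory/Automorphic/Liu2021/AppendixC/{DefC1toC3, DefC4, PropC5, Glue}.lean`, whose slots are indexed the way the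
appendix indexes them: by the REAL embeddings `τ ∈ Φ_F` of `F⁺` (`PropC5Data.V τ`, `.Gτ τ`, `.fix τ`, `.Sh τ τ'`; Def. C.4
«`τ`-nearby»; Rem. C.2 «signature `(n−1,1)` at `τ` and `(n,0)` at other places»), by «`τ' ∈ Φ_E` above `τ`» (`C5.IsAbove`,
`AppendixC.LiesAbove`, `AppendixC.restr`), and by the CM-type selectors `τ^- = CMType.above Φ τ`, `τ^+ = CMType.aboveConj Φ τ`
(l. 4563).  This file is the bookkeeping dictionary between the two indexings, proved once for EVERY CM field `F`, every
`ι₁`, every `Φ ∋ ι₁` and every `V` (no degree, Galois or face input is used; the guards of the binders only restrict where it is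
applied):

* §1 PLACES.  `τ₁ := restr F⁺ F ι₁` is THE real embedding of `F⁺` under `ι₁`: `C5.IsAbove τ ι₁ ↔ τ = τ₁`
  (`isAbove_iff_eq_restr`), so the binder `hUnif`'s «`∀ τ, C5.IsAbove τ ι₁ → …`» quantifies over one `τ`
  (`forall_isAbove_iff`); the three typed spellings of «`τ'` above `τ`» agree (`isAbove_iff_liesAbove`, `isAbove_iff_restr_eq`);
  the embeddings above `τ₁` are exactly `ι₁` and `ῑ₁ = conjugate ι₁` (`eq_or_eq_conjugate_of_isAbove`, `isAbove_restr_conjugate` —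
  the slot of package P2′), and for `σ` above `τ`: `C5.IsAbove τ₁ σ ↔ mk σ = mk ι₁` (`isAbove_restr_iff_mk_eq`), i.e. Liu's
  «other places `τ ≠ τ₁`» are the tree's «embeddings off the place of `ι₁`» of `HermSpace3.posDef_of_ne`.  Also
  `(conjugate ι).fieldRange = ι.fieldRange` for every embedding of a CM field (`fieldRange_conjugate`; no Galois hypothesis) —
  the subfield equality behind the `ῑ₁`-slot of the honest `PropC5Data` (s2crux-idea-1 checklist U2-2).
* §2 SIGNATURES AT EVERY ARCHIMEDEAN PLACE — NOT HERE: in Def. C.4's typed currency (`AppendixC.HasSignatureAt`) the tree's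
  `V` has signature `(2,1)` at `τ₁` and `(3,0)` at every `τ ≠ τ₁`; these are hcomp-compare-1's `HermSpace3.hasSignatureAt_restr` /
  `HermSpace3.hasSignatureAt_of_ne` (`Transposition/HComp/HermSpaceCompare.lean`, row C1 of the team table, with the `LiesAbove`
  spellings `CMField.liesAbove_restr_iff_mk_eq` of part of §1); the eigenvalue-count form is the tree's
  `HermSpace3.card_pos_eigenvalues_of_mk_eq` / `_of_mk_ne` (`CorCM/HermSpaceTransport.lean`).  This file only re-indexes the
  definiteness field `posDef_of_ne` by Liu's `Φ_F` (`posDef_map_of_isAbove`).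
* §3 CM TYPE.  For every `Φ ∋ ι₁`: `CMType.above F⁺ F Φ τ₁ = ι₁` and `CMType.aboveConj F⁺ F Φ τ₁ = ῑ₁` (Liu's `τ₁^- = ι₁`,
  `τ₁^+ = ῑ₁`), and for `τ ≠ τ₁` both `τ^-` and `τ^+` lie off the place of `ι₁`, where `V` is positive definite
  (`posDef_map_above`, `posDef_map_aboveConj`) — the bookkeeping behind Rem. C.2's «the Hodge map `h^♭_{V,Φ}` hence the Shimura
  variety `Sh(G, h^♭_{V,Φ})_K` depend only on `Φ ∩ π^{−1}τ`» (l. 4602–4603; recorded as NOT TYPED in `DefC1toC3.lean`): the only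
  place with `q_τ ≠ 0` is `τ₁`, and `Φ`'s member there is `ι₁` whatever `Φ ∋ ι₁` is.  For a rank-four face `f : Face F` with `ι₁`
  admissible (`Face.Admissible`, `CM/Basic.lean` :133) this applies to `Φ := f.Φ` (`Face.above_restr_eq_of_admissible`).

Everything here is elementary (our bookkeeping on the typed vocabulary); the citation tags point at the printed sentences whose
typed forms are related, not at any result of [Liu2021].  HC_CM is NOT proved.

References: Y. Liu, *Fourier–Jacobi cycles and arithmetic relative trace formula*, Camb. J. Math. 9 (2021) = arXiv:2102.11518
(`FJcycle.tex` md5 6db49a74122d): App. C l. 4550 (`Φ_F`, `Φ_E`, `π`, CM types), l. 4558 / 4573 (signatures), (C.1) l. 4559–4563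
(`τ^±`), Rem. C.2 l. 4602–4603, Def. C.4 l. 4620–4622, l. 4624, Prop. C.5 l. 4627–4633.
-/

noncomputable section

open scoped Matrix ComplexOrder

namespace Summit.HodgeConjecture.CorCM.HComp

open NumberField NumberField.ComplexEmbedding
open Literature.AlgebraicGeometry.Motives (CMType)
open Literature.AlgebraicGeometry.ShimuraVarieties
open Literature.NumberTheory.Automorphic.Liu2021.AppendixC

/-! ## §1  Places: `τ₁ = restr F⁺ F ι₁`, «above», the conjugate slot -/

section Places

variable {F : CMField}

/-- The three typed spellings of «`τ' ∈ Φ_E` above `τ ∈ Φ_F`» agree, I: typer-3's `C5.IsAbove τ σ` (PropC5.lean, «for every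
`τ' ∈ Φ_E` above it», l. 4628) is typer-2's `LiesAbove σ τ` (DefC4.lean, l. 4550). [cite: Liu2021, App. C l. 4550 and Prop. C.5 l. 4628] -/
theorem isAbove_iff_liesAbove (τ : maximalRealSubfield F →+* ℝ) (σ : F →+* ℂ) :
    C5.IsAbove τ σ ↔ LiesAbove σ τ := by
  refine ⟨fun h x => ?_, fun h => RingHom.ext fun x => ?_⟩
  · have := congrArg (fun f : maximalRealSubfield F →+* ℂ => f x) h
    simpa using this
  · simpa using h x

/-- The three typed spellings agree, II: `C5.IsAbove τ σ` iff `π σ = τ` for typer-1's restriction map `π = restr` (DefC1toC3.lean,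
«the projection map `π : Φ_E → Φ_F` given by restriction», l. 4550). [cite: Liu2021, App. C l. 4550 and Prop. C.5 l. 4628] -/
theorem isAbove_iff_restr_eq (τ : maximalRealSubfield F →+* ℝ) (σ : F →+* ℂ) :
    C5.IsAbove τ σ ↔ restr (maximalRealSubfield F) F σ = τ :=
  (restr_eq_iff (maximalRealSubfield F) F σ τ).symm

/-- **`τ₁ := restr F⁺ F ι₁` is THE real embedding under `ι₁`**: `C5.IsAbove τ ι₁ ↔ τ = τ₁`.  Hence every slot of the Appendix-C
carriers that the binders read «at `τ` below `ι₁`» is the slot at `τ₁`. [cite: Liu2021, App. C l. 4550 and Prop. C.5 l. 4628] -/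
theorem isAbove_iff_eq_restr (τ : maximalRealSubfield F →+* ℝ) (ι₁ : F →+* ℂ) :
    C5.IsAbove τ ι₁ ↔ τ = restr (maximalRealSubfield F) F ι₁ := by
  rw [isAbove_iff_restr_eq, eq_comm]

/-- The real embedding under a complex embedding is unique. [cite: Liu2021, App. C l. 4550] -/
theorem isAbove_unique {τ τ' : maximalRealSubfield F →+* ℝ} {σ : F →+* ℂ} (h : C5.IsAbove τ σ) (h' : C5.IsAbove τ' σ) :
    τ = τ' := by
  rw [(isAbove_iff_eq_restr τ σ).1 h, (isAbove_iff_eq_restr τ' σ).1 h']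

/-- **Quantifier bookkeeping for `hUnif`**: a statement demanded «for every `τ ∈ Φ_F` with `ι₁` above `τ`» is the statement at
the single real embedding `τ₁ = restr F⁺ F ι₁` (the shape of the binder `hUnif` of `Model.hComp_of_unif_of_alb`,
`Item6PinReachGlue.lean` :171–172). [cite: Liu2021, Prop. C.5 l. 4628] -/
theorem forall_isAbove_iff (ι₁ : F →+* ℂ) (P : (maximalRealSubfield F →+* ℝ) → Prop) :
    (∀ τ : maximalRealSubfield F →+* ℝ, C5.IsAbove τ ι₁ → P τ) ↔ P (restr (maximalRealSubfield F) F ι₁) :=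
  ⟨fun h => h _ ((isAbove_iff_restr_eq _ ι₁).2 rfl), fun h τ hτ => by rwa [(isAbove_iff_eq_restr τ ι₁).1 hτ]⟩

/-- Complex-conjugate embeddings lie above the same real embedding. [cite: Liu2021, App. C l. 4550] -/
theorem isAbove_conjugate_iff (τ : maximalRealSubfield F →+* ℝ) (σ : F →+* ℂ) :
    C5.IsAbove τ (conjugate σ) ↔ C5.IsAbove τ σ := by
  rw [isAbove_iff_restr_eq, isAbove_iff_restr_eq, restr_conjugate]

/-- **The `ῑ₁`-slot** (package P2′ of the pinning lane: pin along `e ι₁ := conj ∘ ι₁`): `ῑ₁ = conjugate ι₁` lies above `τ₁`.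
[cite: Liu2021, App. C l. 4550 and Prop. C.5 l. 4628] -/
theorem isAbove_restr_conjugate (ι₁ : F →+* ℂ) :
    C5.IsAbove (restr (maximalRealSubfield F) F ι₁) (conjugate ι₁) :=
  (isAbove_conjugate_iff _ ι₁).2 ((isAbove_iff_restr_eq _ ι₁).2 rfl)

/-- `conjugate ι₁` spelled as the composite `(starRingEnd ℂ) ∘ ι₁` (the spelling of `Item6PinReachAlong.lean` §4) lies above `τ₁`.
[cite: Liu2021, App. C l. 4550 and Prop. C.5 l. 4628] -/
theorem isAbove_restr_starRingEnd_comp (ι₁ : F →+* ℂ) :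
    C5.IsAbove (restr (maximalRealSubfield F) F ι₁) ((starRingEnd ℂ).comp ι₁) :=
  isAbove_restr_conjugate ι₁

/-- **The fibre of `π` over `τ₁` is `{ι₁, ῑ₁}`**: an embedding above the real embedding under `ι₁` is `ι₁` or its conjugate
(`F/F⁺` quadratic; typer-1's `eq_or_eq_conjugate_of_restr_eq`). [cite: Liu2021, App. C l. 4550] -/
theorem eq_or_eq_conjugate_of_isAbove {τ : maximalRealSubfield F →+* ℝ} {σ ι₁ : F →+* ℂ} (hσ : C5.IsAbove τ σ)
    (hι : C5.IsAbove τ ι₁) : σ = ι₁ ∨ σ = conjugate ι₁ :=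
  eq_or_eq_conjugate_of_restr_eq (maximalRealSubfield F) F
    (((isAbove_iff_restr_eq τ σ).1 hσ).trans ((isAbove_iff_restr_eq τ ι₁).1 hι).symm)

/-- **Liu's real places vs the tree's infinite places**: `σ` lies above `τ₁ = restr F⁺ F ι₁` iff `σ` and `ι₁` define the same
infinite place of `F` — so «`τ ≠ τ₁`» (Rem. C.2's «other places», Def. C.4 for `τ ≠ τ₁`) is «`mk σ ≠ mk ι₁`» for any `σ` above
`τ` (the hypothesis of `HermSpace3.posDef_of_ne`). [cite: Liu2021, App. C l. 4550 and Rem. C.2 l. 4602–4603] -/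
theorem isAbove_restr_iff_mk_eq (ι₁ σ : F →+* ℂ) :
    C5.IsAbove (restr (maximalRealSubfield F) F ι₁) σ ↔ InfinitePlace.mk σ = InfinitePlace.mk ι₁ := by
  constructor
  · intro h
    rcases eq_or_eq_conjugate_of_isAbove h ((isAbove_iff_restr_eq _ ι₁).2 rfl) with rfl | rfl
    · rfl
    · exact InfinitePlace.mk_conjugate_eq ι₁
  · intro h
    rcases InfinitePlace.mk_eq_iff.1 h with rfl | h'
    · exact (isAbove_iff_restr_eq _ σ).2 rfl
    · rw [← (isAbove_conjugate_iff _ σ), h']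
      exact (isAbove_iff_restr_eq _ ι₁).2 rfl

/-- Contrapositive form used with `posDef_of_ne`: if `σ` lies above some `τ ≠ τ₁` then `σ` is off the place of `ι₁`.
[cite: Liu2021, Rem. C.2 l. 4602–4603] -/
theorem mk_ne_mk_of_isAbove {τ : maximalRealSubfield F →+* ℝ} {σ : F →+* ℂ} (ι₁ : F →+* ℂ) (hσ : C5.IsAbove τ σ)
    (hτ : τ ≠ restr (maximalRealSubfield F) F ι₁) : InfinitePlace.mk σ ≠ InfinitePlace.mk ι₁ := fun h =>
  hτ (isAbove_unique hσ ((isAbove_restr_iff_mk_eq ι₁ σ).2 h))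

/-- Conversely, an embedding off the place of `ι₁` lies above a real embedding `≠ τ₁`. [cite: Liu2021, Rem. C.2 l. 4602–4603] -/
theorem restr_ne_restr_of_mk_ne {σ ι₁ : F →+* ℂ} (h : InfinitePlace.mk σ ≠ InfinitePlace.mk ι₁) :
    restr (maximalRealSubfield F) F σ ≠ restr (maximalRealSubfield F) F ι₁ := fun h' =>
  h ((isAbove_restr_iff_mk_eq ι₁ σ).1 ((isAbove_iff_restr_eq _ σ).2 h'))

/-- Every real embedding `τ` of `F⁺` has an embedding of `F` above it (typer-1's `exists_restr_eq`, in the `C5.IsAbove` spelling).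
[cite: Liu2021, App. C l. 4550] -/
theorem exists_isAbove (τ : maximalRealSubfield F →+* ℝ) : ∃ σ : F →+* ℂ, C5.IsAbove τ σ := by
  obtain ⟨σ, hσ⟩ := exists_restr_eq (maximalRealSubfield F) F τ
  exact ⟨σ, (isAbove_iff_restr_eq τ σ).2 hσ⟩

/-- **The image subfield is conjugation-stable**: `(conjugate ι)(F) = ι(F)` for every complex embedding of a CM field (`ῑ = ι ∘ c`
with `c` the complex conjugation of `F`, an automorphism).  This is the subfield equality `ῑ₁(E) = ι₁(E)` behind the `ῑ₁`-slot of an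
honest `PropC5Data` (no Galois hypothesis needed). [cite: Liu2021, Rem. C.2 l. 4603 («the reflex field of `h_{V,τ'}` is `τ'(E)`»)] -/
theorem fieldRange_conjugate (ι : F →+* ℂ) : (conjugate ι).fieldRange = ι.fieldRange := by
  ext z
  simp only [RingHom.mem_fieldRange]
  constructor
  · rintro ⟨x, rfl⟩
    exact ⟨IsCMField.complexConj F x, by rw [conjugate_coe_eq, IsCMField.complexEmbedding_complexConj]⟩
  · rintro ⟨x, rfl⟩
    refine ⟨IsCMField.complexConj F x, ?_⟩
    rw [conjugate_coe_eq, IsCMField.complexEmbedding_complexConj, starRingEnd_self_apply]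

/-- Same subfield equality in the `(starRingEnd ℂ).comp ι` spelling. [cite: Liu2021, Rem. C.2 l. 4603] -/
theorem fieldRange_starRingEnd_comp (ι : F →+* ℂ) : ((starRingEnd ℂ).comp ι).fieldRange = ι.fieldRange :=
  fieldRange_conjugate ι

end Places

/-! ## §3  CM types: `τ₁^- = ι₁` for every `Φ ∋ ι₁`; `V` is definite at `τ^±` for `τ ≠ τ₁` -/

section CMTypes

variable {F : CMField} {ι₁ : F →+* ℂ}

/-- Positive definiteness at EVERY embedding above a real embedding `τ ≠ τ₁` (the tree's field `posDef_of_ne`, re-indexed by Liu's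
`Φ_F`). [cite: Liu2021, Rem. C.2 (l. 4602–4603)] -/
theorem posDef_map_of_isAbove (V : HermSpace3 F ι₁) {τ : maximalRealSubfield F →+* ℝ} {σ : F →+* ℂ} (hσ : C5.IsAbove τ σ)
    (hτ : τ ≠ restr (maximalRealSubfield F) F ι₁) : (V.Hm.map σ).PosDef :=
  V.posDef_of_ne σ (mk_ne_mk_of_isAbove ι₁ hσ hτ)

/-- **`τ₁^- = ι₁`**: for every CM type `Φ ∋ ι₁`, the element of `Φ` above `τ₁ = restr F⁺ F ι₁` is `ι₁` itself (Liu's `τ^-`,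
l. 4563, `CMType.above`). [cite: Liu2021, App. C (C.1) l. 4559–4563] -/
theorem above_restr_eq {Φ : CMType F} (hι : ι₁ ∈ Φ.1) :
    CMType.above (maximalRealSubfield F) F Φ (restr (maximalRealSubfield F) F ι₁) = ι₁ :=
  (CMType.eq_above (maximalRealSubfield F) F hι rfl).symm

/-- **`τ₁^+ = ῑ₁`**: the element of `Φ^c` above `τ₁` is the conjugate of `ι₁`. [cite: Liu2021, App. C (C.1) l. 4559–4563] -/
theorem aboveConj_restr_eq {Φ : CMType F} (hι : ι₁ ∈ Φ.1) :
    CMType.aboveConj (maximalRealSubfield F) F Φ (restr (maximalRealSubfield F) F ι₁) = conjugate ι₁ := by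
  rw [CMType.aboveConj_eq_conjugate_above, above_restr_eq hι]

/-- `τ^-` lies above `τ`, in the `C5.IsAbove` spelling. [cite: Liu2021, App. C (C.1) l. 4563] -/
theorem isAbove_above (Φ : CMType F) (τ : maximalRealSubfield F →+* ℝ) :
    C5.IsAbove τ (CMType.above (maximalRealSubfield F) F Φ τ) :=
  (isAbove_iff_restr_eq τ _).2 (CMType.above_spec (maximalRealSubfield F) F Φ τ).2

/-- `τ^+` lies above `τ`, in the `C5.IsAbove` spelling. [cite: Liu2021, App. C (C.1) l. 4563] -/
theorem isAbove_aboveConj (Φ : CMType F) (τ : maximalRealSubfield F →+* ℝ) :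
    C5.IsAbove τ (CMType.aboveConj (maximalRealSubfield F) F Φ τ) :=
  (isAbove_iff_restr_eq τ _).2 (CMType.aboveConj_spec (maximalRealSubfield F) F Φ τ).2

/-- The real embedding `τ` is `τ₁` iff `τ^- = ι₁` (for `Φ ∋ ι₁`): the place of signature `(2,1)` is read off `Φ` through `ι₁` alone.
[cite: Liu2021, Rem. C.2 (l. 4602–4603)] -/
theorem above_eq_iff {Φ : CMType F} (hι : ι₁ ∈ Φ.1) (τ : maximalRealSubfield F →+* ℝ) :
    CMType.above (maximalRealSubfield F) F Φ τ = ι₁ ↔ τ = restr (maximalRealSubfield F) F ι₁ := by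
  constructor
  · intro h
    rw [← h]
    exact ((CMType.above_spec (maximalRealSubfield F) F Φ τ).2).symm
  · rintro rfl
    exact above_restr_eq hι

/-- For `τ ≠ τ₁`, `τ^-` is off the place of `ι₁`. [cite: Liu2021, Rem. C.2 (l. 4602–4603)] -/
theorem mk_above_ne (Φ : CMType F) {τ : maximalRealSubfield F →+* ℝ} (hτ : τ ≠ restr (maximalRealSubfield F) F ι₁) :
    InfinitePlace.mk (CMType.above (maximalRealSubfield F) F Φ τ) ≠ InfinitePlace.mk ι₁ :=
  mk_ne_mk_of_isAbove ι₁ (isAbove_above Φ τ) hτ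

/-- For `τ ≠ τ₁`, `τ^+` is off the place of `ι₁`. [cite: Liu2021, Rem. C.2 (l. 4602–4603)] -/
theorem mk_aboveConj_ne (Φ : CMType F) {τ : maximalRealSubfield F →+* ℝ} (hτ : τ ≠ restr (maximalRealSubfield F) F ι₁) :
    InfinitePlace.mk (CMType.aboveConj (maximalRealSubfield F) F Φ τ) ≠ InfinitePlace.mk ι₁ :=
  mk_ne_mk_of_isAbove ι₁ (isAbove_aboveConj Φ τ) hτ

/-- **`V` is positive definite at `τ^-` for every `τ ≠ τ₁`** (so the `τ`-component of `h^♭_{V,Φ}`, `diag(I_{p_τ}, (z/z̄) I_{q_τ})`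
in the coordinates at `τ^-`, is scalar: `q_τ = 0`). [cite: Liu2021, Rem. C.2 (l. 4602–4603), l. 4579–4598] -/
theorem posDef_map_above (V : HermSpace3 F ι₁) (Φ : CMType F) {τ : maximalRealSubfield F →+* ℝ}
    (hτ : τ ≠ restr (maximalRealSubfield F) F ι₁) : (V.Hm.map (CMType.above (maximalRealSubfield F) F Φ τ)).PosDef :=
  V.posDef_of_ne _ (mk_above_ne Φ hτ)

/-- `V` is positive definite at `τ^+` for every `τ ≠ τ₁`. [cite: Liu2021, Rem. C.2 (l. 4602–4603)] -/
theorem posDef_map_aboveConj (V : HermSpace3 F ι₁) (Φ : CMType F) {τ : maximalRealSubfield F →+* ℝ}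
    (hτ : τ ≠ restr (maximalRealSubfield F) F ι₁) : (V.Hm.map (CMType.aboveConj (maximalRealSubfield F) F Φ τ)).PosDef :=
  V.posDef_of_ne _ (mk_aboveConj_ne Φ hτ)

/-- **Rem. C.2's dependence bookkeeping**: two CM types containing `ι₁` have the SAME member above the unique place of signature
`(2,1)` (namely `ι₁`); at every other place `V` is definite at both members.  This is what «`h^♭_{V,Φ}` … depend[s] only on
`Φ ∩ π^{−1}τ`» (l. 4602–4603) rests on, for the tree's `V` and every pair `Φ, Φ' ∋ ι₁`. [cite: Liu2021, Rem. C.2 (l. 4602–4603)] -/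
theorem above_restr_eq_above_restr {Φ Φ' : CMType F} (hι : ι₁ ∈ Φ.1) (hι' : ι₁ ∈ Φ'.1) :
    CMType.above (maximalRealSubfield F) F Φ (restr (maximalRealSubfield F) F ι₁) =
      CMType.above (maximalRealSubfield F) F Φ' (restr (maximalRealSubfield F) F ι₁) := by
  rw [above_restr_eq hι, above_restr_eq hι']

/-- **Rank-four faces**: for a face `f = (Φ; π, π′)` of `F` with `ι₁` admissible (`ι₁ ∈ Φ`, the place of `ι₁` is neither `π` nor
`π′`; `CM/Basic.lean` :133), Liu's `τ₁^-` for the face's CM type is `ι₁`. [cite: Liu2021, App. C (C.1) l. 4559–4563] -/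
theorem Face.above_restr_eq_of_admissible (f : Face F) (h : f.Admissible ι₁) :
    CMType.above (maximalRealSubfield F) F f.Φ (restr (maximalRealSubfield F) F ι₁) = ι₁ :=
  above_restr_eq h.1

/-- For an admissible `ι₁` the face places `π`, `π′` lie above real embeddings `≠ τ₁` (so `V` is definite at `p`, `p'`).
[cite: Liu2021, Rem. C.2 (l. 4602–4603)] -/
theorem Face.restr_p_ne_of_admissible (f : Face F) (h : f.Admissible ι₁) :
    restr (maximalRealSubfield F) F f.p ≠ restr (maximalRealSubfield F) F ι₁ ∧
      restr (maximalRealSubfield F) F f.p' ≠ restr (maximalRealSubfield F) F ι₁ :=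
  ⟨restr_ne_restr_of_mk_ne (fun e => h.2.1 e.symm), restr_ne_restr_of_mk_ne (fun e => h.2.2 e.symm)⟩

/-- `V` is positive definite at the two face places of an admissible face datum. [cite: Liu2021, Rem. C.2 (l. 4602–4603)] -/
theorem Face.posDef_map_p_of_admissible (V : HermSpace3 F ι₁) (f : Face F) (h : f.Admissible ι₁) :
    (V.Hm.map f.p).PosDef ∧ (V.Hm.map f.p').PosDef :=
  ⟨V.posDef_of_ne _ (fun e => h.2.1 e.symm), V.posDef_of_ne _ (fun e => h.2.2 e.symm)⟩

end CMTypes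

end Summit.HodgeConjecture.CorCM.HComp

end
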